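import Summits.AtomisticToContinuum.FouriersLaw.Theorems.HonestZwanzigOrthogonalOhmDirichletBoundAux1
import Summits.AtomisticToContinuum.FouriersLaw.Theorems.HonestZwanzigFeshbachIdentitiesCovariance
import Summits.AtomisticToContinuum.FouriersLaw.Theorems.HonestZwanzigFeshbachIdentitiesSiteEnergy

/-!
# HonestZwanzig / OrthogonalOhm — stub F2 `DirichletBound` (line `Sketch`, skeleton v5)

Support file for crux item `stmt-AtomisticToContinuum-12693` (`HonestZwanzig.OrthogonalOhm`, sub-problem
`FouriersLaw`), line `Sketch`, registered stub `stub_dirichletBound`.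

For the pinned anharmonic chain `P = pinnedChain ω₂ lam β γ` (`ω₂ > 0`, `lam, β ≥ 0`, `γ > 0`), `N ≥ 2`, equal
bath temperatures `T > 0`, Gibbs density `ρ = e^{-H/T}`, and a pointwise solution `w ∈ C²` of `L w = -g` with
`g w ρ, p_b² w² ρ ∈ L¹` (e.g. `w, g` continuous and `O(e^{H/(8T)})`, `integrable_weights` of the helper file):

* `integrable_sq_partialP_mul_gibbsDensity` — `(∂_{p_b} w)² ρ ∈ L¹` at both bath sites (cutoff identity of the
  helper file, Young's inequality on the cross terms with `|∂_{p_b}χ_R| ≤ (M/R)|p_b|`, Fatou as `R → ∞`);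
* `dirichlet_identity` — `γT (∫ (∂_{p_0}w)² ρ + ∫ (∂_{p_{N-1}}w)² ρ) = ∫ g w ρ` (dominated convergence, the cross
  terms are `O(1/R)`);
* `stub_dirichletBound` — the registered signature: `(∂_{p_0}w)² ∈ L¹(μ_T)`,
  `γT ∫ (∂_{p_0}w)² dμ_T ≤ ∫ (u - m) w dμ_T`, and `μ_T` charges `(∂_{p_0}w)²` wherever it is non-zero.
-/

noncomputable section

open MeasureTheory Filter Topology Set Function
open scoped ContDiff
open Literature.MathematicalPhysics.KineticTheory.HeatConduction

namespace Summit.AtomisticToContinuum.FouriersLaw.Theorems.HonestZwanzig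

namespace OrthogonalOhmLine.DirichletBound

open Summit.AtomisticToContinuum.FouriersLaw.Theorems.OddSectorIrreversibility
  (contDiff_energyCutoff hasCompactSupport_energyCutoff tendsto_energyCutoff_atTop)
open Summit.AtomisticToContinuum.FouriersLaw.Theorems.SubdiffusiveBondHeat (exists_bound_deriv_smoothCutoff)

variable {N : ℕ}

section Pinned

variable {ω₂ lam β γ : ℝ} (hω : 0 < ω₂) (hl : 0 ≤ lam) (hβ : 0 ≤ β) (hN : 2 ≤ N) {T : ℝ} (hT : 0 < T)
include hω hl hβ hN hT

/-- **Finite Dirichlet form at the baths.** For `w ∈ C²` with `L_{T,T} w = -g` pointwise, `g w e^{-H/T} ∈ L¹`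
and `p_b² w² e^{-H/T} ∈ L¹` (`γ > 0`): `(∂_{p_b} w)² e^{-H/T} ∈ L¹` for `b ∈ {0, N-1}` — from the cutoff
identity by Young's inequality on the cross terms (`|∂_{p_b}χ_R| ≤ (M/R)|p_b|`) the cut-off Dirichlet forms are
bounded uniformly in `R ≥ 1`, and Fatou. -/
theorem integrable_sq_partialP_mul_gibbsDensity (hγ : 0 < γ) {w g : PhaseSpace N → ℝ} (hw : ContDiff ℝ 2 w)
    (hg : Continuous g) (hLw : ∀ x, (pinnedChain ω₂ lam β γ).generator N T T w x = -g x)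
    (hgw : Integrable (fun x => g x * w x * (pinnedChain ω₂ lam β γ).gibbsDensity N T x))
    (hpw : ∀ i : Fin N, Integrable (fun x => x.2 i ^ 2 * w x ^ 2 * (pinnedChain ω₂ lam β γ).gibbsDensity N T x)) :
    Integrable (fun x => (partialP ⟨0, by omega⟩ w x) ^ 2 * (pinnedChain ω₂ lam β γ).gibbsDensity N T x) ∧
    Integrable (fun x => (partialP ⟨N - 1, by omega⟩ w x) ^ 2 * (pinnedChain ω₂ lam β γ).gibbsDensity N T x) := by
  set P := pinnedChain ω₂ lam β γ with hP
  set ρ := P.gibbsDensity N T with hρ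
  obtain ⟨M, hM0, hM⟩ := exists_bound_deriv_smoothCutoff
  set b₀ : Fin N := ⟨0, by omega⟩ with hb₀
  set b₁ : Fin N := ⟨N - 1, by omega⟩ with hb₁
  set χ : ℝ → PhaseSpace N → ℝ := fun R x => smoothCutoff (P.hamiltonian N x / R) with hχ
  have hρc : Continuous ρ := pinnedChain_continuous_gibbsDensity ω₂ lam β γ N T
  have hρ0 : ∀ x, 0 ≤ ρ x := fun x => (P.gibbsDensity_pos N T x).le
  have hχs : ∀ R, ContDiff ℝ ∞ (χ R) := fun R => contDiff_energyCutoff (ω₂ := ω₂) (lam := lam) (β := β) γ N R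
  have hχcont : ∀ R, Continuous (χ R) := fun R => (hχs R).continuous
  have hχ0 : ∀ R x, 0 ≤ χ R x := fun R x => smoothCutoff_nonneg _
  have hχ1 : ∀ R x, χ R x ≤ 1 := fun R x => smoothCutoff_le_one _
  have hPwc : ∀ i, Continuous (partialP i w) := fun i => continuous_partialP hw two_ne_zero i
  have hγT : 0 < γ * T := mul_pos hγ hT
  -- the cut-off Dirichlet forms and their uniform bound
  set D : ℝ → Fin N → ℝ := fun R i => ∫ x, (partialP i w x) ^ 2 * (χ R x * χ R x) * ρ x with hD
  set W : Fin N → ℝ := fun i => ∫ x, x.2 i ^ 2 * w x ^ 2 * ρ x with hW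
  set GW : ℝ := ∫ x, |g x * w x * ρ x| with hGW
  set C : ℝ := 2 / (γ * T) * (GW + 2 * (γ * T) * M ^ 2 * (W b₀ + W b₁)) with hC
  have hD0 : ∀ R i, 0 ≤ D R i := fun R i =>
    integral_nonneg fun x => mul_nonneg (mul_nonneg (sq_nonneg _) (mul_nonneg (hχ0 R x) (hχ0 R x))) (hρ0 x)
  have hW0 : ∀ i, 0 ≤ W i := fun i =>
    integral_nonneg fun x => mul_nonneg (mul_nonneg (sq_nonneg _) (sq_nonneg _)) (hρ0 x)
  have key : ∀ R : ℝ, 1 ≤ R → D R b₀ + D R b₁ ≤ C := by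
    intro R hR1
    have hR : 0 < R := by linarith
    have hχRd : Differentiable ℝ (χ R) := (hχs R).differentiable (by simp)
    have hχRc : HasCompactSupport (χ R) := hasCompactSupport_energyCutoff hω hl hβ γ N hR
    have hid := cutoff_identity hω hl hβ hN hT hw hLw hR (χ := χ R) (fun x => rfl)
    -- Young on the cross terms: `-2E_i ≤ D_i/2 + 2(M/R)² W_i`
    have hE : ∀ i : Fin N, -(2 * ∫ x, w x * χ R x * partialP i (χ R) x * partialP i w x * ρ x) ≤
        D R i / 2 + 2 * (M / R) ^ 2 * W i := by
      intro i
      have hPχc : Continuous (partialP i (χ R)) := continuous_partialP (hχs R) (by simp) i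
      have hPχcs : HasCompactSupport (partialP i (χ R)) := hasCompactSupport_partialP hχRd hχRc i
      have iE : Integrable fun x => -(2 * (w x * χ R x * partialP i (χ R) x * partialP i w x * ρ x)) := by
        have h := ((((((hw.continuous.mul (hχcont R)).mul hPχc).mul (hPwc i)).mul hρc
          ).integrable_of_hasCompactSupport (μ := volume) (hPχcs.mul_left.mul_right.mul_right)).const_mul 2).neg
        exact h
      have iDf : Integrable fun x => (partialP i w x) ^ 2 * (χ R x * χ R x) * ρ x :=
        ((((hPwc i).pow 2).mul ((hχcont R).mul (hχcont R))).mul hρc).integrable_of_hasCompactSupport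
          ((hχRc.mul_left (f := χ R)).mul_left.mul_right)
      have hpt : ∀ x, -(2 * (w x * χ R x * partialP i (χ R) x * partialP i w x * ρ x)) ≤
          (partialP i w x) ^ 2 * (χ R x * χ R x) * ρ x / 2 + 2 * (M / R) ^ 2 * (x.2 i ^ 2 * w x ^ 2 * ρ x) := by
        intro x
        have hd : |partialP i (χ R) x| ≤ M / R * |x.2 i| := abs_partialP_energyCutoff_le P N hR hM i x
        have hy := (neg_le_abs _).trans (abs_cross_le_young (w := w x) (χ := χ R x) (dw := partialP i w x) hd)
        have h2 := mul_le_mul_of_nonneg_right hy (hρ0 x)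
        have e1 : -(2 * (w x * χ R x * partialP i (χ R) x * partialP i w x)) * ρ x =
            -(2 * (w x * χ R x * partialP i (χ R) x * partialP i w x * ρ x)) := by ring
        have e2 : (partialP i w x ^ 2 * (χ R x * χ R x) / 2 + 2 * (M / R) ^ 2 * (x.2 i ^ 2 * w x ^ 2)) * ρ x =
            (partialP i w x) ^ 2 * (χ R x * χ R x) * ρ x / 2 + 2 * (M / R) ^ 2 * (x.2 i ^ 2 * w x ^ 2 * ρ x) := by
          ring
        rw [e1, e2] at h2
        exact h2
      calc -(2 * ∫ x, w x * χ R x * partialP i (χ R) x * partialP i w x * ρ x)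
          = ∫ x, -(2 * (w x * χ R x * partialP i (χ R) x * partialP i w x * ρ x)) := by
            rw [← integral_const_mul, ← integral_neg]
        _ ≤ ∫ x, ((partialP i w x) ^ 2 * (χ R x * χ R x) * ρ x / 2 +
            2 * (M / R) ^ 2 * (x.2 i ^ 2 * w x ^ 2 * ρ x)) :=
            integral_mono iE ((iDf.div_const 2).add ((hpw i).const_mul _)) hpt
        _ = D R i / 2 + 2 * (M / R) ^ 2 * W i := by
            rw [integral_add (iDf.div_const 2) ((hpw i).const_mul _), integral_div, integral_const_mul]
    -- `∫ g w χ² ρ ≤ ∫ |g w ρ|`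
    have hGWχ : ∫ x, g x * w x * (χ R x * χ R x) * ρ x ≤ GW := by
      have hle : ∀ x, |g x * w x * (χ R x * χ R x) * ρ x| ≤ |g x * w x * ρ x| := by
        intro x
        rw [abs_mul, abs_mul, abs_mul (g x * w x), abs_of_nonneg (mul_nonneg (hχ0 R x) (hχ0 R x))]
        have hχχ : χ R x * χ R x ≤ 1 := by nlinarith [hχ0 R x, hχ1 R x]
        calc |g x * w x| * (χ R x * χ R x) * |ρ x| ≤ |g x * w x| * 1 * |ρ x| :=
            mul_le_mul_of_nonneg_right (mul_le_mul_of_nonneg_left hχχ (abs_nonneg _)) (abs_nonneg _)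
          _ = |g x * w x| * |ρ x| := by ring
      have iχ : Integrable (fun x => g x * w x * (χ R x * χ R x) * ρ x) :=
        hgw.abs.mono' ((((hg.mul hw.continuous).mul ((hχcont R).mul (hχcont R))).mul hρc).aestronglyMeasurable)
          (Eventually.of_forall fun x => by rw [Real.norm_eq_abs]; exact hle x)
      calc ∫ x, g x * w x * (χ R x * χ R x) * ρ x ≤ |∫ x, g x * w x * (χ R x * χ R x) * ρ x| := le_abs_self _
        _ ≤ ∫ x, |g x * w x * (χ R x * χ R x) * ρ x| := abs_integral_le_integral_abs
        _ ≤ GW := integral_mono iχ.abs hgw.abs hle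
    have hA := mul_le_mul_of_nonneg_left (hE b₀) hγT.le
    have hB := mul_le_mul_of_nonneg_left (hE b₁) hγT.le
    have hsum : γ * T * (D R b₀ + D R b₁) / 2 ≤ GW + 2 * (γ * T) * (M / R) ^ 2 * (W b₀ + W b₁) := by
      have hid' : ∫ x, g x * w x * (χ R x * χ R x) * ρ x = γ * T * ((D R b₀ +
          2 * ∫ x, w x * χ R x * partialP b₀ (χ R) x * partialP b₀ w x * ρ x) + (D R b₁ +
          2 * ∫ x, w x * χ R x * partialP b₁ (χ R) x * partialP b₁ w x * ρ x)) := hid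
      linarith [hid', hA, hB, hGWχ]
    have hMR : (M / R) ^ 2 ≤ M ^ 2 := by
      rw [div_pow]; exact div_le_self (sq_nonneg M) (one_le_pow₀ hR1)
    have hx := mul_le_mul_of_nonneg_left hMR
      (mul_nonneg (by positivity : (0 : ℝ) ≤ 2 * (γ * T)) (add_nonneg (hW0 b₀) (hW0 b₁)))
    have hsum' : γ * T * (D R b₀ + D R b₁) / 2 ≤ GW + 2 * (γ * T) * M ^ 2 * (W b₀ + W b₁) := by
      linarith [hsum, hx]
    rw [hC, div_mul_eq_mul_div, le_div_iff₀ hγT]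
    linarith [hsum']
  -- Fatou
  have hFatou : ∀ i : Fin N, (∀ R : ℝ, 1 ≤ R → D R i ≤ C) →
      Integrable (fun x => (partialP i w x) ^ 2 * ρ x) := by
    intro i hi
    refine integrable_of_integral_cutoff_le (κ := fun R x => χ R x * χ R x)
      ((((hPwc i).pow 2).mul hρc).aestronglyMeasurable) (fun x => mul_nonneg (sq_nonneg _) (hρ0 x))
      (fun R => ((hχcont R).mul (hχcont R)).aestronglyMeasurable) (fun R x => mul_nonneg (hχ0 R x) (hχ0 R x))
      (fun x => ?_) ?_ (C := C) ?_
    · have h := tendsto_energyCutoff_atTop P N x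
      simpa using h.mul h
    · filter_upwards [eventually_gt_atTop 0] with R hR
      have hχRc : HasCompactSupport (χ R) := hasCompactSupport_energyCutoff hω hl hβ γ N hR
      exact ((((hχcont R).mul (hχcont R)).mul (((hPwc i).pow 2).mul hρc))).integrable_of_hasCompactSupport
        ((hχRc.mul_left (f := χ R)).mul_right)
    · filter_upwards [eventually_ge_atTop 1] with R hR
      have e : ∫ x, χ R x * χ R x * ((partialP i w x) ^ 2 * ρ x) = D R i := by
        simp only [hD]
        exact integral_congr_ae (Eventually.of_forall fun x => by ring)
      rw [e]
      exact hi R hR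
  exact ⟨hFatou b₀ fun R hR => (le_add_of_nonneg_right (hD0 R b₁)).trans (key R hR),
    hFatou b₁ fun R hR => (le_add_of_nonneg_left (hD0 R b₀)).trans (key R hR)⟩

/-- **The Dirichlet identity** `γT (∫ (∂_{p_0}w)² e^{-H/T} + ∫ (∂_{p_{N-1}}w)² e^{-H/T}) = ∫ g w e^{-H/T}`: the
limit `R → ∞` of the cutoff identity (dominated convergence; the cross terms are `O(1/R)` since
`|w χ_R ∂_{p_b}χ_R ∂_{p_b}w| ≤ (M/2R)(p_b²w² + (∂_{p_b}w)²)`). -/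
theorem dirichlet_identity (hγ : 0 < γ) {w g : PhaseSpace N → ℝ} (hw : ContDiff ℝ 2 w)
    (hg : Continuous g) (hLw : ∀ x, (pinnedChain ω₂ lam β γ).generator N T T w x = -g x)
    (hgw : Integrable (fun x => g x * w x * (pinnedChain ω₂ lam β γ).gibbsDensity N T x))
    (hpw : ∀ i : Fin N, Integrable (fun x => x.2 i ^ 2 * w x ^ 2 * (pinnedChain ω₂ lam β γ).gibbsDensity N T x)) :
    γ * T * ((∫ x, (partialP ⟨0, by omega⟩ w x) ^ 2 * (pinnedChain ω₂ lam β γ).gibbsDensity N T x) +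
        ∫ x, (partialP ⟨N - 1, by omega⟩ w x) ^ 2 * (pinnedChain ω₂ lam β γ).gibbsDensity N T x) =
      ∫ x, g x * w x * (pinnedChain ω₂ lam β γ).gibbsDensity N T x := by
  obtain ⟨hD₀, hD₁⟩ := integrable_sq_partialP_mul_gibbsDensity hω hl hβ hN hT hγ hw hg hLw hgw hpw
  set P := pinnedChain ω₂ lam β γ with hP
  set ρ := P.gibbsDensity N T with hρ
  obtain ⟨M, hM0, hM⟩ := exists_bound_deriv_smoothCutoff
  set b₀ : Fin N := ⟨0, by omega⟩ with hb₀
  set b₁ : Fin N := ⟨N - 1, by omega⟩ with hb₁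
  set χ : ℝ → PhaseSpace N → ℝ := fun R x => smoothCutoff (P.hamiltonian N x / R) with hχ
  have hρc : Continuous ρ := pinnedChain_continuous_gibbsDensity ω₂ lam β γ N T
  have hρ0 : ∀ x, 0 ≤ ρ x := fun x => (P.gibbsDensity_pos N T x).le
  have hχs : ∀ R, ContDiff ℝ ∞ (χ R) := fun R => contDiff_energyCutoff (ω₂ := ω₂) (lam := lam) (β := β) γ N R
  have hχcont : ∀ R, Continuous (χ R) := fun R => (hχs R).continuous
  have hχ0 : ∀ R x, 0 ≤ χ R x := fun R x => smoothCutoff_nonneg _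
  have hχ1 : ∀ R x, χ R x ≤ 1 := fun R x => smoothCutoff_le_one _
  have hχχ1 : ∀ R x, χ R x * χ R x ≤ 1 := fun R x => by nlinarith [hχ0 R x, hχ1 R x]
  have hPwc : ∀ i, Continuous (partialP i w) := fun i => continuous_partialP hw two_ne_zero i
  have hlimχ : ∀ x, Tendsto (fun R => χ R x * χ R x) atTop (𝓝 1) := fun x => by
    have h := tendsto_energyCutoff_atTop P N x
    simpa using h.mul h
  -- the cross terms are `O(1/R)`
  have hE : ∀ i : Fin N, Integrable (fun x => (partialP i w x) ^ 2 * ρ x) →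
      Tendsto (fun R => ∫ x, w x * χ R x * partialP i (χ R) x * partialP i w x * ρ x) atTop (𝓝 0) := by
    intro i hDi
    set K : ℝ := ((∫ x, x.2 i ^ 2 * w x ^ 2 * ρ x) + ∫ x, (partialP i w x) ^ 2 * ρ x) / 2 with hK
    have hbound : ∀ R, 0 < R →
        |∫ x, w x * χ R x * partialP i (χ R) x * partialP i w x * ρ x| ≤ M / R * K := by
      intro R hR
      have hpt : ∀ x, |w x * χ R x * partialP i (χ R) x * partialP i w x * ρ x| ≤
          M / R * ((x.2 i ^ 2 * w x ^ 2 * ρ x + (partialP i w x) ^ 2 * ρ x) / 2) := by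
        intro x
        have hd : |partialP i (χ R) x| ≤ M / R * |x.2 i| := abs_partialP_energyCutoff_le P N hR hM i x
        have h1 : |χ R x| ≤ 1 := by rw [abs_of_nonneg (hχ0 R x)]; exact hχ1 R x
        have hy := abs_cross_le_amgm (w := w x) (dw := partialP i w x) (div_nonneg hM0 hR.le) h1 hd
        rw [abs_mul, abs_of_nonneg (hρ0 x)]
        have h2 := mul_le_mul_of_nonneg_right hy (hρ0 x)
        have e : M / R * (((x.2 i * w x) ^ 2 + partialP i w x ^ 2) / 2) * ρ x =
            M / R * ((x.2 i ^ 2 * w x ^ 2 * ρ x + (partialP i w x) ^ 2 * ρ x) / 2) := by ring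
        rw [e] at h2
        exact h2
      have iI : Integrable fun x => (x.2 i ^ 2 * w x ^ 2 * ρ x + (partialP i w x) ^ 2 * ρ x) / 2 :=
        ((hpw i).add hDi).div_const 2
      calc |∫ x, w x * χ R x * partialP i (χ R) x * partialP i w x * ρ x|
          ≤ ∫ x, |w x * χ R x * partialP i (χ R) x * partialP i w x * ρ x| := abs_integral_le_integral_abs
        _ ≤ ∫ x, M / R * ((x.2 i ^ 2 * w x ^ 2 * ρ x + (partialP i w x) ^ 2 * ρ x) / 2) :=
            integral_mono_of_nonneg (Eventually.of_forall fun x => abs_nonneg _) (iI.const_mul _)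
              (Eventually.of_forall hpt)
        _ = M / R * K := by rw [integral_const_mul, hK, integral_div, integral_add (hpw i) hDi]
    have hlim : Tendsto (fun R : ℝ => M / R * K) atTop (𝓝 0) := by
      have h : Tendsto (fun R : ℝ => M * K / R) atTop (𝓝 0) := tendsto_const_nhds.div_atTop tendsto_id
      exact h.congr fun R => by ring
    refine squeeze_zero_norm' ?_ hlim
    filter_upwards [eventually_gt_atTop 0] with R hR
    rw [Real.norm_eq_abs]
    exact hbound R hR
  -- the cut-off Dirichlet forms converge (dominated convergence)
  have hDlim : ∀ i : Fin N, Integrable (fun x => (partialP i w x) ^ 2 * ρ x) →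
      Tendsto (fun R => ∫ x, (partialP i w x) ^ 2 * (χ R x * χ R x) * ρ x) atTop
        (𝓝 (∫ x, (partialP i w x) ^ 2 * ρ x)) := by
    intro i hDi
    refine tendsto_integral_filter_of_dominated_convergence (fun x => (partialP i w x) ^ 2 * ρ x) ?_ ?_ hDi ?_
    · exact Eventually.of_forall fun R =>
        ((((hPwc i).pow 2).mul ((hχcont R).mul (hχcont R))).mul hρc).aestronglyMeasurable
    · refine Eventually.of_forall fun R => Eventually.of_forall fun x => ?_
      rw [Real.norm_eq_abs, abs_of_nonneg (mul_nonneg (mul_nonneg (sq_nonneg _)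
        (mul_nonneg (hχ0 R x) (hχ0 R x))) (hρ0 x))]
      calc (partialP i w x) ^ 2 * (χ R x * χ R x) * ρ x ≤ (partialP i w x) ^ 2 * 1 * ρ x :=
          mul_le_mul_of_nonneg_right (mul_le_mul_of_nonneg_left (hχχ1 R x) (sq_nonneg _)) (hρ0 x)
        _ = (partialP i w x) ^ 2 * ρ x := by ring
    · exact Eventually.of_forall fun x => by
        simpa using (((hlimχ x).const_mul ((partialP i w x) ^ 2)).mul_const (ρ x))
  -- `∫ g w χ² ρ → ∫ g w ρ`
  have hGlim : Tendsto (fun R => ∫ x, g x * w x * (χ R x * χ R x) * ρ x) atTop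
      (𝓝 (∫ x, g x * w x * ρ x)) := by
    refine tendsto_integral_filter_of_dominated_convergence (fun x => ‖g x * w x * ρ x‖) ?_ ?_ hgw.norm ?_
    · exact Eventually.of_forall fun R =>
        (((hg.mul hw.continuous).mul ((hχcont R).mul (hχcont R))).mul hρc).aestronglyMeasurable
    · refine Eventually.of_forall fun R => Eventually.of_forall fun x => ?_
      rw [Real.norm_eq_abs, Real.norm_eq_abs, abs_mul, abs_mul, abs_mul (g x * w x),
        abs_of_nonneg (mul_nonneg (hχ0 R x) (hχ0 R x))]
      calc |g x * w x| * (χ R x * χ R x) * |ρ x| ≤ |g x * w x| * 1 * |ρ x| :=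
          mul_le_mul_of_nonneg_right (mul_le_mul_of_nonneg_left (hχχ1 R x) (abs_nonneg _)) (abs_nonneg _)
        _ = |g x * w x| * |ρ x| := by ring
    · exact Eventually.of_forall fun x => by
        simpa using (((hlimχ x).const_mul (g x * w x)).mul_const (ρ x))
  -- pass to the limit in the cutoff identity
  have hlim2 : Tendsto (fun R => ∫ x, g x * w x * (χ R x * χ R x) * ρ x) atTop
      (𝓝 (γ * T * (((∫ x, (partialP b₀ w x) ^ 2 * ρ x) + 2 * 0) +
        ((∫ x, (partialP b₁ w x) ^ 2 * ρ x) + 2 * 0)))) := by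
    have h := ((((hDlim b₀ hD₀).add ((hE b₀ hD₀).const_mul 2)).add
      ((hDlim b₁ hD₁).add ((hE b₁ hD₁).const_mul 2))).const_mul (γ * T))
    refine h.congr' ?_
    filter_upwards [eventually_gt_atTop 0] with R hR
    exact (cutoff_identity hω hl hβ hN hT hw hLw hR (χ := χ R) (fun x => rfl)).symm
  have := tendsto_nhds_unique hGlim hlim2
  rw [this]
  ring

end Pinned

end OrthogonalOhmLine.DirichletBound

open OrthogonalOhmLine.DirichletBound in
/-- **Stub F2** (`DirichletBound`, fixed `N`) of crux `HonestZwanzig.OrthogonalOhm`, line `Sketch`: for a smooth,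
admissibly bounded pointwise solution `w` of `L w = −(u − m)` (`u = Σ ξ_x e_x`, the split-site energy profile),
the left-bath Dirichlet form is finite and dominated by the pairing, `γT ∫ (∂_{p_0} w)² dμ_T ≤ ∫ (u − m) w dμ_T`
(indeed `γT(‖∂_{p_0}w‖² + ‖∂_{p_{N-1}}w‖²)_{μ_T} = ⟨u − m, w⟩_{μ_T}`, `dirichlet_identity`), and `μ_T` charges
`(∂_{p_0} w)²` wherever it is non-zero (continuity, positive density). -/
theorem stub_dirichletBound :
    ∀ ω₂ lam β γ : ℝ, 0 < ω₂ → 0 < lam → 0 < β → 0 < γ → ∀ T : ℝ, 0 < T → ∀ N : ℕ, ∀ hN : 2 ≤ N, ∀ ξ : Fin N → ℝ, let P := Literature.MathematicalPhysics.KineticTheory.HeatConduction.pinnedChain ω₂ lam β γ; let X := Literature.MathematicalPhysics.KineticTheory.HeatConduction.PhaseSpace N; let μ : MeasureTheory.Measure X := P.gibbsMeasure N T; let e : Fin N → X → ℝ := fun x z => z.2 x ^ 2 / 2 + P.U (z.1 x) + ∑ j : Fin N, ((if j.val = x.val + 1 then P.V (z.1 j - z.1 x) / 2 else 0) + (if x.val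 = j.val + 1 then P.V (z.1 x - z.1 j) / 2 else 0)); let u : X → ℝ := fun z => ∑ x : Fin N, ξ x * e x z; let m : ℝ := ∫ z, u z ∂μ;
      ∀ w : X → ℝ, ContDiff ℝ ∞ w →
        (∃ A : ℝ, ∀ z, |w z| ≤ A * Real.exp (P.hamiltonian N z / (8 * T))) →
        (∀ z, P.generator N T T w z = -(u z - m)) →
        MeasureTheory.Integrable (fun z => (Literature.MathematicalPhysics.KineticTheory.HeatConduction.partialP ⟨0, by omega⟩ w z) ^ 2) μ ∧
        γ * T * ∫ z, (Literature.MathematicalPhysics.KineticTheory.HeatConduction.partialP ⟨0, by omega⟩ w z) ^ 2 ∂μ ≤ ∫ z, (u z - m) * w z ∂μ ∧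
        ((∃ z, Literature.MathematicalPhysics.KineticTheory.HeatConduction.partialP ⟨0, by omega⟩ w z ≠ 0) →
          0 < ∫ z, (Literature.MathematicalPhysics.KineticTheory.HeatConduction.partialP ⟨0, by omega⟩ w z) ^ 2 ∂μ) := by
  intro ω₂ lam β γ hω hl hβ hγ T hT N hN ξ P X μ e u m w hw hAw hLw
  -- the right-hand side `u - m` is continuous and `O(e^{H/(8T)})`
  have hnice := fun x => pinnedChain_splitSite_nice (ω₂ := ω₂) (lam := lam) (β := β) (γ := γ) (N := N) e
    (fun x z => rfl) hω hl.le hβ.le x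
  have huc : Continuous u := continuous_finsetSum _ fun x _ => continuous_const.mul (hnice x).1
  have hgc : Continuous fun z => u z - m := huc.sub continuous_const
  have hϑ : (0 : ℝ) < 1 / (8 * T) := by positivity
  have hub : ∀ z, |u z| ≤ (∑ x, |ξ x| * (((N : ℝ) + 2) / (1 / (8 * T)))) *
      Real.exp (1 / (8 * T) * P.hamiltonian N z) := fun z =>
    abs_sum_mul_le_exp_bound Finset.univ (fun x y => (hnice x).2.2.2 _ hϑ y) ξ z
  have hgb : ∀ z, |u z - m| ≤ ((∑ x, |ξ x| * (((N : ℝ) + 2) / (1 / (8 * T)))) + |m|) *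
      Real.exp (P.hamiltonian N z / (8 * T)) := by
    intro z
    have hH0 : 0 ≤ P.hamiltonian N z := pinnedChain_hamiltonian_nonneg hω.le hl.le hβ.le γ N z
    have h1 : 1 ≤ Real.exp (P.hamiltonian N z / (8 * T)) := Real.one_le_exp (by positivity)
    have hexp : Real.exp (1 / (8 * T) * P.hamiltonian N z) = Real.exp (P.hamiltonian N z / (8 * T)) := by
      congr 1; ring
    calc |u z - m| ≤ |u z| + |m| := abs_sub _ _
      _ ≤ (∑ x, |ξ x| * (((N : ℝ) + 2) / (1 / (8 * T)))) * Real.exp (P.hamiltonian N z / (8 * T)) +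
          |m| * Real.exp (P.hamiltonian N z / (8 * T)) :=
          add_le_add (by rw [← hexp]; exact hub z) (le_mul_of_one_le_right (abs_nonneg m) h1)
      _ = _ := by ring
  obtain ⟨A, hA⟩ := hAw
  have hw2 : ContDiff ℝ 2 w := hw.of_le (by norm_cast)
  have hLw' : ∀ z, P.generator N T T w z = -(fun z => u z - m) z := hLw
  obtain ⟨hgw, hpw⟩ := integrable_weights hω hl.le hβ.le hT hw.continuous hgc hA hgb
  obtain ⟨hD₀, -⟩ := integrable_sq_partialP_mul_gibbsDensity hω hl.le hβ.le hN hT hγ hw2 hgc hLw' hgw hpw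
  have hid := dirichlet_identity hω hl.le hβ.le hN hT hγ hw2 hgc hLw' hgw hpw
  have hZ : 0 ≤ (∫ x, P.gibbsDensity N T x)⁻¹ :=
    inv_nonneg.2 (integral_nonneg fun x => (P.gibbsDensity_pos N T x).le)
  have hD₁0 : 0 ≤ ∫ x, (partialP ⟨N - 1, by omega⟩ w x) ^ 2 * P.gibbsDensity N T x :=
    integral_nonneg fun x => mul_nonneg (sq_nonneg _) (P.gibbsDensity_pos N T x).le
  refine ⟨P.integrable_gibbsMeasure hD₀, ?_, ?_⟩
  · rw [P.integral_gibbsMeasure, P.integral_gibbsMeasure]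
    have hγT : 0 < γ * T := mul_pos hγ hT
    have hle : γ * T * ∫ x, (partialP ⟨0, by omega⟩ w x) ^ 2 * P.gibbsDensity N T x ≤
        ∫ x, (u x - m) * w x * P.gibbsDensity N T x := by
      linarith [hid, mul_nonneg hγT.le hD₁0]
    calc γ * T * ((∫ x, P.gibbsDensity N T x)⁻¹ * ∫ x, (partialP ⟨0, by omega⟩ w x) ^ 2 * P.gibbsDensity N T x)
        = (∫ x, P.gibbsDensity N T x)⁻¹ *
            (γ * T * ∫ x, (partialP ⟨0, by omega⟩ w x) ^ 2 * P.gibbsDensity N T x) := by ring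
      _ ≤ (∫ x, P.gibbsDensity N T x)⁻¹ * ∫ x, (u x - m) * w x * P.gibbsDensity N T x :=
        mul_le_mul_of_nonneg_left hle hZ
  · rintro ⟨z₀, hz₀⟩
    have hc : Continuous fun z => (partialP ⟨0, by omega⟩ w z) ^ 2 := (continuous_partialP hw (by simp) _).pow 2
    exact pinnedChain_integral_gibbsMeasure_pos hω hl.le hβ.le hT hc (fun z => sq_nonneg _) (z₀ := z₀)
      (by positivity) hD₀

end Summit.AtomisticToContinuum.FouriersLaw.Theorems.HonestZwanzig

end
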